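import Summits.NavierStokesRegularity.NavierStokesRegularity.Theses.QuantisedSymmetry
import Summits.NavierStokesRegularity.NavierStokesRegularity.Theses.Blowup
import Summits.NavierStokesRegularity.NavierStokesRegularity.Theses.FilamentSkeletonRss
import Summits.NavierStokesRegularity.NavierStokesRegularity.Theorems.QuantisedSymmetryPolyhedralDssProfileExistsDominatesBlowupProfile
import Summits.NavierStokesRegularity.NavierStokesRegularity.Theorems.FilamentSkeletonRssRdssProfileTruncation
import Summits.NavierStokesRegularity.NavierStokesRegularity.Theorems.SoloInformedClayDichotomy
import Summits.NavierStokesRegularity.NavierStokesRegularity.Theorems.QuantisedSymmetryPolyhedralTruncationBridge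
import Literature.Analysis.FluidPDE.SelfSimilarLiouville
import HarnessLib

/-!
# Strategist sketch s21-g7 (independent census, family `s`, generation 7) — crux
# `QuantisedSymmetry.PolyhedralDssProfileExists` (X⁻, stmt-NavierStokesRegularity-1404)

Typed companion of `Cruxes/PolyhedralDssProfileExists/STRATEGY-CENSUS-s21.md`.  Sorry-free; nothing here
is proposed to `Theorems/`.

* §1 WEAKER INTERMEDIATES, read off the summit statement downwards: `W0` (= `Blowup.BlowupExists`, a
  Schwartz-datum finite-time blow-up), `W2` (a Type-I blow-up), `W1` (= `Blowup.BlowupTypeIDssProfile`,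
  stmt-0155: a Type-I (rotated) λ-DSS profile, NO symmetry group), `W1'` (its unrotated form at one λ).
  The PROVED chain `X⁻ → W1' → W1 → W0 → ¬ NavierStokesRegularity → NavierStokesBreakdownR3` is assembled
  from tree theorems only (`exists_not_typeIDSSLiouville_of_polyhedralDssProfileExists`,
  `filamentSkeletonRss_rdssProfileTruncation_proof`, `Literature.NS.blowup_assembly` via
  `Blowup.Assembly_holds`, `QuantisedSymmetry.ClayUniqueness_holds`, `navierStokesRegularity_or_breakdownR3`):
  every intermediate weak enough to be implied by X⁻ and strong enough to feed `closes` already decides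
  the Clay dichotomy on the breakdown side (prize-strength), and none of them is known to imply X⁻ back.
* §2 the crux re-packaged over two predicates (`IsPolyhedralGroup`, `IsProfileWitness`) so that the
  decomposition and strengthening candidates of the census can be stated compactly; `x_iff`.
* §3 STRENGTHENINGS S⁺ as Props with the trivial projections S⁺ → X⁻ (`UniqueProfileWitness`,
  `WindowedProfileWitness`); the census argues why the added rigidity buys nothing for this step.
-/

set_option linter.dupNamespace false
set_option autoImplicit false

namespace Summit.NavierStokesRegularity.NavierStokesRegularity.Cruxes.PolyhedralDssProfileExists.StrategistS21g7

open MeasureTheory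
open Literature.Analysis.FluidPDE

/-- `ℝ³`. -/
abbrev E3 := EuclideanSpace ℝ (Fin 3)

/-- The crux X⁻ (the route decl, by name). -/
abbrev X : Prop := Theses.QuantisedSymmetry.PolyhedralDssProfileExists

/-! ## §1 Weaker intermediates, from the summit statement down -/

/-- W0 = X5a: finite-time blow-up of a maximal smooth Leray–Hopf solution from a rapidly decaying datum
(route `Blowup`, crux #2). -/
abbrev W0 : Prop := Theses.Blowup.BlowupExists

/-- W1 = stmt-NavierStokesRegularity-0155: a nontrivial Type-I (rotated) λ-DSS ancient mild profile exists
for some λ > 1 (and rotation R); no symmetry group. -/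
abbrev W1 : Prop := Theses.Blowup.BlowupTypeIDssProfile

/-- W1′: the unrotated form — for some `λ > 1` Tsai's Type-I λ-DSS Liouville statement fails. -/
def W1' : Prop := ∃ c : ℝ, 1 < c ∧ ¬ TypeIDSSLiouville c

/-- W2: a Type-I blow-up exists (W0 plus the rate `‖u(t,x)‖ ≤ C/√(T−t)` on `[0,T)`). -/
def W2 : Prop :=
  ∃ ν : ℝ, 0 < ν ∧ ∃ T : ℝ, 0 < T ∧ ∃ (u : ℝ → E3 → E3) (p : ℝ → E3 → ℝ),
    IsMaximalSmoothSolution ν 0 u p T ∧ IsLerayHopfOn T ν 0 (u 0) u ∧ HasRapidSpatialDecay (u 0) ∧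
      ∃ C : ℝ, ∀ t ∈ Set.Ico 0 T, ∀ x, ‖u t x‖ ≤ C / Real.sqrt (T - t)

/-- X⁻ → W1′ (tree: `exists_not_typeIDSSLiouville_of_polyhedralDssProfileExists`, lead c15). -/
theorem w1'_of_x (hX : X) : W1' :=
  Theorems.PolyhedralDssProfileExists.PolyhedralCell.exists_not_typeIDSSLiouville_of_polyhedralDssProfileExists hX

/-- X⁻ → W1 (tree: the registered and proved stub `stub_dominatesBlowupProfile`). -/
theorem w1_of_x (hX : X) : W1 :=
  Theorems.PolyhedralDssProfileExists.PolyhedralCell.stub_dominatesBlowupProfile hX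

/-- W1′ → W1 (the unrotated disjunct). -/
theorem w1_of_w1' (h : W1') : W1 := by
  obtain ⟨c, -, hc⟩ := h
  dsimp only [W1, Theses.Blowup.BlowupTypeIDssProfile]
  exact fun hL => hc (hL c).1

/-- W1 unpacked (classical logic): a rotated-DSS Type-I nontrivial ancient mild witness `(λ, R, u)`; the
unrotated disjunct is embedded with `R = refl` via `isRotatedDSS_refl_iff`. -/
theorem rdssWitness_of_w1 (h : W1) :
    ∃ (c : ℝ) (R : E3 ≃ₗᵢ[ℝ] E3) (u : ℝ → E3 → E3), 1 < c ∧ IsAncientMildSolution 1 u ∧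
      (∀ t < 0, AEStronglyMeasurable (u t) volume) ∧ IsRotatedDSS c R u ∧
        (∃ C₀ : ℝ, HasTypeIDecay C₀ u) ∧ ¬ (∀ t < 0, u t =ᵐ[volume] 0) := by
  dsimp only [W1, Theses.Blowup.BlowupTypeIDssProfile] at h
  by_contra hne
  exact h fun c =>
    ⟨fun hc u hmild hmeas hdss hdec => Classical.by_contradiction fun hnt =>
        hne ⟨c, LinearIsometryEquiv.refl ℝ E3, u, hc, hmild, hmeas, isRotatedDSS_refl_iff.mpr hdss, hdec, hnt⟩,
      fun R hc u hmild hmeas hrdss hdec => Classical.by_contradiction fun hnt =>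
        hne ⟨c, R, u, hc, hmild, hmeas, hrdss, hdec, hnt⟩⟩

/-- W1 → W0: the symmetry-free truncation bridge is PROVED in the tree
(`filamentSkeletonRss_rdssProfileTruncation_proof`, stmt-NavierStokesRegularity-11289, pseudo-stable steering),
so the bare profile already yields a Schwartz-datum blow-up — the group clauses of X⁻ are used nowhere. -/
theorem w0_of_w1 (h : W1) : W0 :=
  Theorems.filamentSkeletonRss_rdssProfileTruncation_proof (rdssWitness_of_w1 h)

/-- W2 → W0 (drop the rate). -/
theorem w0_of_w2 (h : W2) : W0 := by
  obtain ⟨ν, hν, T, hT, u, p, hmax, hLH, hdec, -⟩ := h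
  dsimp only [W0, Theses.Blowup.BlowupExists]
  exact ⟨ν, hν, T, hT, u, p, hmax, hLH, hdec⟩

/-- W0 → ¬ NavierStokesRegularity: route `Blowup`'s assembly (`Literature.NS.blowup_assembly`) with the
PROVED Clay-class uniqueness `QuantisedSymmetry.ClayUniqueness_holds` (stmt-0153). -/
theorem not_nsr_of_w0 (h : W0) : ¬ _root_.NavierStokesRegularity :=
  Theses.Blowup.Assembly_holds ⟨h, Theses.QuantisedSymmetry.ClayUniqueness_holds⟩

/-- … hence Clay (C) (`navierStokesRegularity_or_breakdownR3`). -/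
theorem breakdown_of_w0 (h : W0) : Literature.Analysis.FluidPDE.NavierStokesBreakdownR3 :=
  (Theorems.navierStokesRegularity_or_breakdownR3).resolve_left (not_nsr_of_w0 h)

/-- Every intermediate on the list is prize-deciding: W1 ⟹ Clay (C). -/
theorem breakdown_of_w1 (h : W1) : Literature.Analysis.FluidPDE.NavierStokesBreakdownR3 := breakdown_of_w0 (w0_of_w1 h)

/-- … and so is the crux itself (this is just `closes` with its two proved co-hypotheses discharged). -/
theorem breakdown_of_x (hX : X) : Literature.Analysis.FluidPDE.NavierStokesBreakdownR3 := breakdown_of_w1 (w1_of_x hX)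

/-- `closes` with both proved co-hypotheses discharged: X⁻ alone refutes the summit. -/
theorem not_nsr_of_x (hX : X) : ¬ _root_.NavierStokesRegularity :=
  Theses.QuantisedSymmetry.closes hX Theorems.quantisedSymmetry_polyhedralTruncationBridge_proof
    Theses.QuantisedSymmetry.ClayUniqueness_holds

/-! ## §2 The crux over two predicates -/

/-- The group clauses of X⁻: a finite, proper (det = 1), irreducible subgroup of `O(3)` (i.e. T, O or I). -/
def IsPolyhedralGroup (G : Subgroup (E3 ≃ₗᵢ[ℝ] E3)) : Prop :=
  Finite G ∧ (∀ g ∈ G, LinearMap.det (g.toLinearEquiv : E3 →ₗ[ℝ] E3) = 1) ∧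
    ∀ V : Submodule ℝ E3, (∀ g ∈ G, ∀ v ∈ V, g v ∈ V) → V = ⊥ ∨ V = ⊤

/-- The witness clauses of X⁻ at fixed group `G` and factor `c`. -/
def IsProfileWitness (G : Subgroup (E3 ≃ₗᵢ[ℝ] E3)) (c : ℝ) (u : ℝ → E3 → E3) : Prop :=
  IsAncientMildSolution 1 u ∧ (∀ t < 0, AEStronglyMeasurable (u t) volume) ∧ IsDiscretelySelfSimilar c u ∧
    (∃ C₀ : ℝ, HasTypeIDecay C₀ u) ∧ (∀ g ∈ G, ∀ t x, u t (g x) = g (u t x)) ∧ ¬ (∀ t < 0, u t =ᵐ[volume] 0)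

/-- X⁻ ↔ ∃ polyhedral G, ∃ c > 1, ∃ witness. -/
theorem x_iff : X ↔ ∃ G, IsPolyhedralGroup G ∧ ∃ c : ℝ, 1 < c ∧ ∃ u, IsProfileWitness G c u := by
  dsimp only [X, Theses.QuantisedSymmetry.PolyhedralDssProfileExists, IsPolyhedralGroup, IsProfileWitness]
  constructor
  · rintro ⟨G, hfin, hdet, hirr, c, hc, u, hmild, hmeas, hdss, hdec, heqv, hnt⟩
    exact ⟨G, ⟨hfin, hdet, hirr⟩, c, hc, u, hmild, hmeas, hdss, hdec, heqv, hnt⟩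
  · rintro ⟨G, ⟨hfin, hdet, hirr⟩, c, hc, u, hmild, hmeas, hdss, hdec, heqv, hnt⟩
    exact ⟨G, hfin, hdet, hirr, c, hc, u, hmild, hmeas, hdss, hdec, heqv, hnt⟩

/-! ## §3 Strengthenings S⁺ (typed; each projects to X⁻ trivially) -/

/-- S⁺₁ (rigid / isolated form): a witness which is the UNIQUE witness for its `(G, c)` up to parabolic
rescaling `nsRescale μ`.  Rigidity of this kind is what a contraction or an implicit-function argument would
deliver — but the only contraction regime of the period map is the small-data one, whose fixed point is 0
(Chae–Wolf 2017 Rem. 1.4 / tree N2 `stub_smallConstant`), so S⁺₁ exposes no tool that X⁻ lacks. -/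
def UniqueProfileWitness : Prop :=
  ∃ G, IsPolyhedralGroup G ∧ ∃ c : ℝ, 1 < c ∧ ∃ u, IsProfileWitness G c u ∧
    ∀ u', IsProfileWitness G c u' → ∃ μ : ℝ, 0 < μ ∧ u' = nsRescale μ u

theorem x_of_unique (h : UniqueProfileWitness) : X := by
  obtain ⟨G, hG, c, hc, u, hu, -⟩ := h
  exact x_iff.mpr ⟨G, hG, c, hc, u, hu⟩

/-- S⁺₂ (windowed form): a witness with factor in a prescribed window `c ≤ c₁` and Type-I constant `≤ K`.
By tree N1/N2 (`stub_periodWindow`, `stub_smallConstant`: Chae–Wolf 2017 Thm 1.3 / Rem 1.4) any witness has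
`c` bounded AWAY from 1 and `C₀` bounded away from 0, so windows near the trivial corner are empty and no
continuation in `(c, C₀)` starts from a known solution; a window elsewhere is X⁻ with two constants fixed. -/
def WindowedProfileWitness (c₁ K : ℝ) : Prop :=
  ∃ G, IsPolyhedralGroup G ∧ ∃ c : ℝ, 1 < c ∧ c ≤ c₁ ∧ ∃ u, IsProfileWitness G c u ∧ HasTypeIDecay K u

theorem x_of_windowed {c₁ K : ℝ} (h : WindowedProfileWitness c₁ K) : X := by
  obtain ⟨G, hG, c, hc, -, u, hu, -⟩ := h
  exact x_iff.mpr ⟨G, hG, c, hc, u, hu⟩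

/-! ## §4 The kill switch is weaker than ¬X⁻ only formally

`LiouvilleKillsProfile` (stmt-1408, proved) makes #3 `PolyhedralTypeILiouville` imply `¬ X⁻`; the negation of
#3 (a nontrivial G-equivariant Type-I BOUNDED ancient mild solution, not necessarily DSS) is a consequence
of X⁻ that does NOT feed `closes` (no DSS ⇒ no truncation to a blow-up), recorded here by name only. -/
example : Theses.QuantisedSymmetry.LiouvilleKillsProfile =
    (Theses.QuantisedSymmetry.PolyhedralTypeILiouville → ¬ Theses.QuantisedSymmetry.PolyhedralDssProfileExists) := by
  rfl

end Summit.NavierStokesRegularity.NavierStokesRegularity.Cruxes.PolyhedralDssProfileExists.StrategistS21g7
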